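import Summits.KontsevichZagierPeriods.KontsevichZagierPeriods.Theorems.HurwitzMicroSectorsNormalFormPrincipleAngAddK2
import Summits.KontsevichZagierPeriods.KontsevichZagierPeriods.Theorems.AbelContractionRealHyperellipticSectorPortDlogMoves

/-!
# Route AbelContraction — `RealHyperellipticSector` (crux stmt-KontsevichZagierPeriods-12475):
# the dimension-certified port, layer 2 — the arctangent addition law as ONE rotation move

Helper file of the line `Lines/birth.lean` (stub `stub_bakerAlg`, `--supports` the crux): the port
of `Theorems/HurwitzMicroSectorsNormalFormPrincipleAngAddK2.lean` (namespace
`…NormalFormPrinciple.AngAddK2`) INTO THE BUDGET `KZ.relationsLE 1`. The carriers are the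
representations `RG t d = [(0,t), d/(1+y²)]` (value `d · arctan t`), and the statement is the
addition theorem of the arctangent read inside `KZ.relationsLE 1`: for real algebraic `s, t ≥ 0`
with `st < 1` and algebraic `d`,

  `[RG ((t+s)/(1−st)) d] − [RG s d] − [RG t d] ∈ KZ.relationsLE 1`   (`ang_add_mem_relationsLE`,
  registered sub-goal),

by two moves among representations of dimension `1`:

* rule (1a) (`Port.Dlog.split_mem_relationsLE`, a null point): cut `(0, T)`, `T = (t+s)/(1−st)`,
  at `t`;
* rule (2), ONE change of variables (`moebius_sub_mem_relationsLE`): the Möbius ROTATION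
  `v ↦ (v − t)/(1 + t v)`, `(t, T) → (0, s)`, under which `d·dv/(1+v²)` is invariant. Its
  rule-(2) certificate `cov_one` (membership in `KZ.changeOfVariablesRel`, dimension-free) is
  reused from the original file; inside the budget it is completed by the observation that both
  representations have dimension `1` (`KZ.of_mem_formalRepLE`).

References: M. Kontsevich, D. Zagier, *Periods* (2001), §1.2 rules (1), (2) [KontsevichZagier2001].
No definitions are introduced.
-/

noncomputable section

open MeasureTheory Set MvPolynomial
open Literature.NumberTheory.Transcendental Literature.NumberTheory.Transcendental.KZ
open Literature.ModelTheory.ExponentialFields (IsSemialgebraic)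

namespace Summit.KontsevichZagierPeriods.AbelContraction.RealHyperellipticSector.Port

namespace AngAddK2

open Summit.KontsevichZagierPeriods.HurwitzMicroSectors.NormalFormPrinciple.AngAddK2 (cov_one)
open Summit.KontsevichZagierPeriods.HurwitzMicroSectors.NormalFormPrinciple.PiBox.Dlog
  (isSemialgebraic_setOf_apply_mem_Ioo_of_isAlgebraic)

/-! ## Rule (2) in dimension one inside the budget -/

/-- A change-of-variables instance `[A] − [B] ∈ changeOfVariablesRel` between two representations
of dimension `1` is a truncated relation of `relationsLE 1` (both representations have dimension
`≤ 1`) (inside the budget `relationsLE 1`). [cite: KontsevichZagier2001, §1.2 rule (2)] -/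
theorem mem_relationsLE_of_mem_changeOfVariablesRel (A B : IntegralRep 1)
    (h : of A - of B ∈ changeOfVariablesRel) : of A - of B ∈ relationsLE 1 :=
  movesLE_subset_relationsLE 1
    ⟨Or.inl (Or.inr h), sub_mem (of_mem_formalRepLE A le_rfl) (of_mem_formalRepLE B le_rfl)⟩

/-! ## The Möbius rotation move for the arctangent carriers inside the budget -/

/-- **The Möbius rotation move** (inside the budget `relationsLE 1`). For real algebraic `t ≥ 0`,
real `s ≥ 0` with `ts < 1` and `u (1 − ts) = t + s`, the rotation `v ↦ (v − t)/(1 + tv)` is a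
`ℚ`-semialgebraic bijection `(t, u) → (0, s)` with derivative `(1+t²)/(1+tv)² > 0`, and `d/(1+v²)`
is invariant: `[(t,u), d/(1+y²)] − [(0,s), d/(1+y²)] ∈ relationsLE 1` (one move of rule (2) among
representations of dimension `1`). [cite: KontsevichZagier2001, §1.2 rule (2)] -/
theorem moebius_sub_mem_relationsLE {t s u d : ℝ} (ht0 : 0 ≤ t) (hts : t * s < 1)
    (hu : u * (1 - t * s) = t + s) (hta : IsAlgebraic ℚ t) (A B : IntegralRep 1)
    (hAd : A.domain = {x | x 0 ∈ Set.Ioo t u}) (hAi : A.integrand = fun x => d / (1 + x 0 ^ 2))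
    (hBd : B.domain = {x | x 0 ∈ Set.Ioo 0 s}) (hBi : B.integrand = fun x => d / (1 + x 0 ^ 2)) :
    of A - of B ∈ relationsLE 1 := by
  have hts' : 0 < 1 - t * s := by linarith
  -- denominators are positive on the source interval
  have hden : ∀ x ∈ A.domain, 0 < 1 + t * x 0 := fun x hx => by
    rw [hAd] at hx
    have : 0 ≤ t * x 0 := mul_nonneg ht0 (ht0.trans hx.1.le)
    linarith
  refine mem_relationsLE_of_mem_changeOfVariablesRel A B (cov_one A B
    (fun v => (v - t) / (1 + t * v)) (fun v => (1 + t ^ 2) / (1 + t * v) ^ 2) ?_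
    (fun x hx => ?_) (fun x hx y hy h => ?_) ?_ (fun x hx => ?_))
  · -- semialgebraicity (the coefficient `t` is a real algebraic constant)
    have hS := A.isSemialgebraic_domain
    have hx : IsSemialgebraicFunOn ℚ A.domain fun x => x 0 :=
      (isSemialgebraicFunOn_aeval hS (X 0)).congr fun x _ => by simp
    have hc : IsSemialgebraicFunOn ℚ A.domain fun _ => t :=
      isSemialgebraicFunOn_const_of_isAlgebraic hS hta
    have h1 : IsSemialgebraicFunOn ℚ A.domain fun _ => (1 : ℝ) :=
      (isSemialgebraicFunOn_aeval hS 1).congr fun x _ => by simp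
    exact (IsSemialgebraicFunOn.div (IsSemialgebraicFunOn.sub_holds hx hc)
      (IsSemialgebraicFunOn.add_holds h1 (IsSemialgebraicFunOn.mul_holds hc hx))
      fun x hx => (hden x hx).ne').congr fun x _ => by simp
  · -- derivative
    have h0 := hden x hx
    have hd : HasDerivAt (fun v => (v - t) / (1 + t * v))
        ((1 * (1 + t * x 0) - (x 0 - t) * (t * 1)) / (1 + t * x 0) ^ 2) (x 0) :=
      ((hasDerivAt_id' (x 0)).sub_const t).div (((hasDerivAt_id' (x 0)).const_mul t).const_add 1)
        h0.ne'
    convert hd using 1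
    field_simp
    ring
  · -- injectivity
    have hx0 := hden x hx
    have hy0 := hden y hy
    have h' : (x 0 - t) / (1 + t * x 0) = (y 0 - t) / (1 + t * y 0) := h
    rw [div_eq_div_iff hx0.ne' hy0.ne'] at h'
    have h2 : (x 0 - y 0) * (1 + t ^ 2) = 0 := by linear_combination h'
    rcases mul_eq_zero.mp h2 with h3 | h3
    · exact sub_eq_zero.mp h3
    · exact absurd h3 (by positivity)
  · -- image
    rw [hBd]
    apply Subset.antisymm
    · rintro _ ⟨x, hx, rfl⟩
      have h0 := hden x hx
      rw [hAd] at hx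
      obtain ⟨h1, h2⟩ := hx
      refine ⟨?_, ?_⟩
      · show 0 < (x 0 - t) / (1 + t * x 0)
        exact div_pos (by linarith) h0
      · show (x 0 - t) / (1 + t * x 0) < s
        rw [div_lt_iff₀ h0]
        have hxu : x 0 * (1 - t * s) < u * (1 - t * s) := mul_lt_mul_of_pos_right h2 hts'
        nlinarith [hxu, hu]
    · rintro y ⟨h1, h2⟩
      have htw : 0 < 1 - t * y 0 := by nlinarith [mul_le_mul_of_nonneg_left h2.le ht0]
      refine ⟨fun _ => (y 0 + t) / (1 - t * y 0), ?_, ?_⟩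
      · rw [hAd]
        refine ⟨?_, ?_⟩
        · show t < (y 0 + t) / (1 - t * y 0)
          rw [lt_div_iff₀ htw]
          nlinarith [sq_nonneg t, mul_pos h1 (show (0 : ℝ) < 1 + t ^ 2 by positivity)]
        · show (y 0 + t) / (1 - t * y 0) < u
          rw [div_lt_iff₀ htw]
          have hys : y 0 * (1 + t ^ 2) < s * (1 + t ^ 2) :=
            mul_lt_mul_of_pos_right h2 (by positivity)
          nlinarith [hys, hu, sq_nonneg t]
      · funext i
        rw [Fin.fin_one_eq_zero i]
        show ((y 0 + t) / (1 - t * y 0) - t) / (1 + t * ((y 0 + t) / (1 - t * y 0))) = y 0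
        have hne : 1 - t * y 0 ≠ 0 := htw.ne'
        have hd' : 1 + t * ((y 0 + t) / (1 - t * y 0)) = (1 + t ^ 2) / (1 - t * y 0) := by
          rw [eq_div_iff hne, add_mul, mul_assoc, div_mul_cancel₀ _ hne]
          ring
        have hn' : (y 0 + t) / (1 - t * y 0) - t = y 0 * (1 + t ^ 2) / (1 - t * y 0) := by
          rw [eq_div_iff hne, sub_mul, div_mul_cancel₀ _ hne]
          ring
        rw [hd', hn', div_div_div_cancel_right₀ hne,
          mul_div_cancel_right₀ _ (by positivity : (1 : ℝ) + t ^ 2 ≠ 0)]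
  · -- the form `d dv/(1+v²)` is invariant
    have h0 : 1 + t * x 0 ≠ 0 := (hden x hx).ne'
    have h0' : 0 < 1 + t * x 0 := hden x hx
    rw [hAi, hBi, abs_of_pos (by positivity)]
    simp only
    have key : 1 + ((x 0 - t) / (1 + t * x 0)) ^ 2 =
        (1 + t ^ 2) * (1 + x 0 ^ 2) / (1 + t * x 0) ^ 2 := by
      rw [eq_div_iff (pow_ne_zero 2 h0), add_mul, div_pow, div_mul_cancel₀ _ (pow_ne_zero 2 h0)]
      ring
    have h1 : (1 : ℝ) + t ^ 2 ≠ 0 := by positivity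
    have h2 : (1 : ℝ) + x 0 ^ 2 ≠ 0 := by positivity
    rw [key, div_div_eq_mul_div, div_mul_div_comm,
      div_eq_div_iff h2 (mul_ne_zero (mul_ne_zero h1 h2) (pow_ne_zero 2 h0))]
    ring

/-! ## The addition law inside the budget -/

/-- **The addition law of the arctangent carriers inside `KZ.relationsLE 1`** (registered
sub-goal of crux stmt-KontsevichZagierPeriods-12475, port of `AngAddK2.ang_add_mem_relations`).
For the carriers `RG t d = [(0,t), d/(1+y²)]` (real algebraic data) and real algebraic `s, t ≥ 0`
with `st < 1`: `[RG ((t+s)/(1−st)) d] − [RG s d] − [RG t d] ∈ KZ.relationsLE 1` — cut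
`(0, (t+s)/(1−st))` at the null point `t` (rule (1a) in dimension `1`) and rotate
`(t, (t+s)/(1−st))` onto `(0, s)` by `v ↦ (v−t)/(1+tv)` (rule (2) in dimension `1`, `d·dv/(1+v²)`
invariant) (inside the budget `relationsLE 1`). [cite: KontsevichZagier2001, §1.2 rules (1), (2)] -/
theorem ang_add_mem_relationsLE : ∀ {RG : ℝ → ℝ → KZ.IntegralRep 1},
    (∀ t d, IsAlgebraic ℚ t → IsAlgebraic ℚ d →
      (RG t d).domain = {x | x 0 ∈ Set.Ioo 0 t} ∧ (RG t d).integrand = fun x => d / (1 + x 0 ^ 2)) →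
    ∀ {s t d : ℝ}, IsAlgebraic ℚ s → IsAlgebraic ℚ t → IsAlgebraic ℚ d → 0 ≤ s → 0 ≤ t →
    s * t < 1 →
    KZ.of (RG ((t + s) / (1 - s * t)) d) - KZ.of (RG s d) - KZ.of (RG t d) ∈ KZ.relationsLE 1 := by
  intro RG hRG s t d hs ht hd hs0 ht0 hst
  set T : ℝ := (t + s) / (1 - s * t) with hT
  have hst' : 0 < 1 - s * t := by linarith
  have hTa : IsAlgebraic ℚ T := by
    rw [hT, div_eq_mul_inv]
    exact (ht.add hs).mul (isAlgebraic_one.sub (hs.mul ht)).inv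
  have hTu : T * (1 - t * s) = t + s := by
    rw [hT, mul_comm t s, div_mul_cancel₀ _ hst'.ne']
  have htT : t ≤ T := by
    rw [hT, le_div_iff₀ hst']
    nlinarith [mul_nonneg hs0 (sq_nonneg t), mul_nonneg hs0 ht0]
  obtain ⟨hLd, hLi⟩ := hRG T d hTa hd
  obtain ⟨hL₁d, hL₁i⟩ := hRG t d ht hd
  obtain ⟨hBd, hBi⟩ := hRG s d hs hd
  -- the middle piece `[(t,T), d/(1+y²)]`, a restriction of `RG T d`
  have hPsa : IsSemialgebraic ℚ {x : Fin 1 → ℝ | x 0 ∈ Set.Ioo t T} :=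
    isSemialgebraic_setOf_apply_mem_Ioo_of_isAlgebraic ht hTa 0
  have hPsub : {x : Fin 1 → ℝ | x 0 ∈ Set.Ioo t T} ⊆ (RG T d).domain := by
    rw [hLd]
    exact fun x hx => ⟨ht0.trans_lt hx.1, hx.2⟩
  set A : IntegralRep 1 := (RG T d).restrict _ hPsa hPsub with hA
  -- rule (1a): `[(0,T)] ≡ [(0,t)] + [(t,T)]`
  have hsplit : of (RG T d) - of (RG t d) - of A ∈ relationsLE 1 :=
    Dlog.split_mem_relationsLE (RG T d) (RG t d) A hLd hL₁d (IntegralRep.domain_restrict _ _ _ _)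
      ht0 htT (fun x _ => by rw [hL₁i, hLi]) fun _ _ => rfl
  -- rule (2): `[(t,T)] ≡ [(0,s)]`
  have hrot : of A - of (RG s d) ∈ relationsLE 1 :=
    moebius_sub_mem_relationsLE ht0 (by rwa [mul_comm] at hst) hTu ht A (RG s d)
      (IntegralRep.domain_restrict _ _ _ _) (by rw [hA, IntegralRep.integrand_restrict, hLi]) hBd hBi
  have e : of (RG T d) - of (RG s d) - of (RG t d) =
      (of (RG T d) - of (RG t d) - of A) + (of A - of (RG s d)) := by abel
  rw [e]
  exact add_mem hsplit hrot

end AngAddK2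

end Summit.KontsevichZagierPeriods.AbelContraction.RealHyperellipticSector.Port

end
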